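import Mathlib
import Summits.RiemannHypothesis.RiemannHypothesis.Theorems.WeilFarFloorSecondOrderUpperCoreRH
import Summits.RiemannHypothesis.RiemannHypothesis.Theorems.WeilFarFloorBoxEnvelope
import Summits.RiemannHypothesis.RiemannHypothesis.Theorems.WeilFarFloorModulusClassRH
import Summits.RiemannHypothesis.RiemannHypothesis.Theorems.WeilFarFloorCoshOptimalBudgets
import HarnessLib

/-!
# The second-order UPPER bound for the far-coercivity floor (under RH, abstract budgets)

Helper file (`--supports stmt-RiemannHypothesis-0098`, lead-track anchor: Weil-positivity window ladder, format-C far bound),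
pure proofs.  Seat rh-explicit-weil-1 gen15 (memo `run/shared/lean/pub/rh-explicit/rh-explicit-weil-1/FORMAT-K3.md` §16).

From the one-test estimate `WeilFarFloorSecondOrderUpperCoreRH.primeShiftForm_le_coshQuotient_secondOrder_of_RH` (profile window
`a`, test window `b₂ ≥ a + s²`, exact `2 × 2` block) to the floor: a window function `g` on `[−a, a]` is replaced by its box
envelope `G` on `[−(a + h), a + h]` (`WeilFarFloorBoxEnvelope.exists_boxEnvelope`: same norm, larger form, linear modulus at scale
`h/2`), `G` by a nearby real Weil test `u` on `[−(a + h + ε₁), a + h + ε₁]` (`exists_weilTest_near_of_linearModulus`, the form moves by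
`≤ η∫G²`), and the one-test estimate is applied with the ORIGINAL profile `C_a` inside the enlarged window — so no window
continuity of the cosh quotient or of the coupling is needed; the enlargement only enters the collar terms
`W√(2h + h/8)` (coupling) and `8(h + h/16)P₊` (pole leakage).  Result (`farCoercivityFloor_le_coshQuotient_secondOrder_of_RH`):

  **`λ_max(a) ≤ R_c(a) + 6Ws + (√J_c + e₁)²/((1 − 3s)(R_c(a) − L)) + 11η`**,
  `e₁ = (3/2)s(W + τ) + W√(2h + h/8)`,  `L = 4(a + sinh a + 3)s² + 8(h + h/16)P₊ + 4Ψ(ηh/2)`,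

for every `a ≥ 4`, `0 < h ≤ 1`, `s² ≤ h`, `0 < s ≤ 1/6`, `0 < η ≤ 1`, weight sum `W` of the window `a + h + 1`, approximate
eigenvalue `0 ≤ λ₀ ≤ τ` of `C_a` with coupling budget `J_c`, `P₊ ≥ (a+h+1) + sinh(a+h+1)`, under `L + 1 ≤ R_c(a)`.
With `λ₀ = R_c(a)` the budget `J_c` is the exact residual energy `J(a)` of the second-order law; the discharge of the budgets
(`h = e^{−4a}`, `s = e^{−3a}`, `η = e^{−2a}`: `λ_max(a) ≤ R_c(a) + (1+ε)J(a)/R_c(a) + εe^{−a}` eventually) is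
`WeilFarFloorSecondOrderLawRH`.  Standard axioms only; RH enters as Mathlib's `RiemannHypothesis`.
-/

set_option linter.dupNamespace false
set_option autoImplicit false

noncomputable section

open MeasureTheory Set Filter
open scoped Real Topology ArithmeticFunction.vonMangoldt

namespace Summit.RiemannHypothesis.RiemannHypothesis.Theorems.WeilFormatC

namespace FloorCoshSplit

open Literature.NumberTheory.LFunctions FloorCosh FloorEnvelope FloorSmoothing

/-! ## §1 From a linear-modulus envelope to a Weil test -/

/-- **`L²`-closeness transfers the prime-shift form up to `η∫G²`.**  If `G, u` are admissible on `[−a, a]`, `∫G², ∫u² ≤ N`, the weight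
sum of the window is `≤ W₁`, and `∫(u − G)² ≤ (η/(2(W₁+1)))²·N`, then `|Q_a(G) − Q_a(u)| ≤ η·N`
(`abs_primeShiftForm_sub_le`: the form is `L²`-Lipschitz with constant the weight sum). -/
theorem abs_primeShiftForm_sub_le_of_sq_dist_le {a η W₁ N CG Cu : ℝ} {G u : ℝ → ℝ}
    (hη0 : 0 ≤ η) (hW₁ : ∑ n ∈ weilPrimeIndex a, 2 * ((Λ n : ℝ) / Real.sqrt n) ≤ W₁) (hW₁0 : 0 ≤ W₁) (hN : 0 ≤ N)
    (hGm : Measurable G) (hum : Measurable u) (hGb : ∀ x, |G x| ≤ CG) (hub : ∀ x, |u x| ≤ Cu)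
    (hGs : ∀ x, x ∉ Icc (-a) a → G x = 0) (hus : ∀ x, x ∉ Icc (-a) a → u x = 0)
    (hGN : ∫ x, G x ^ 2 ≤ N) (huN : ∫ x, u x ^ 2 ≤ N)
    (hdist : ∫ x, (u x - G x) ^ 2 ≤ (η / (2 * (W₁ + 1))) ^ 2 * N) :
    |primeShiftForm a G - primeShiftForm a u| ≤ η * N := by
  have hsqrt_dist : Real.sqrt (∫ x, (G x - u x) ^ 2) ≤ η / (2 * (W₁ + 1)) * Real.sqrt N := by
    have e : ∫ x, (G x - u x) ^ 2 = ∫ x, (u x - G x) ^ 2 :=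
      integral_congr_ae (Eventually.of_forall fun x ↦ by simp only; ring)
    rw [e, ← Real.sqrt_sq (by positivity : (0 : ℝ) ≤ η / (2 * (W₁ + 1))), ← Real.sqrt_mul (sq_nonneg _)]
    exact Real.sqrt_le_sqrt hdist
  have hnG : Real.sqrt (∫ x, G x ^ 2) ≤ Real.sqrt N := Real.sqrt_le_sqrt hGN
  have hnu : Real.sqrt (∫ x, u x ^ 2) ≤ Real.sqrt N := Real.sqrt_le_sqrt huN
  have hNN : Real.sqrt N * Real.sqrt N = N := Real.mul_self_sqrt hN
  have hpair : Real.sqrt (∫ x, (G x - u x) ^ 2) * (Real.sqrt (∫ x, G x ^ 2) + Real.sqrt (∫ x, u x ^ 2))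
      ≤ η * N / (W₁ + 1) := by
    calc Real.sqrt (∫ x, (G x - u x) ^ 2) * (Real.sqrt (∫ x, G x ^ 2) + Real.sqrt (∫ x, u x ^ 2))
        ≤ (η / (2 * (W₁ + 1)) * Real.sqrt N) * (2 * Real.sqrt N) :=
          mul_le_mul hsqrt_dist (by linarith only [hnG, hnu])
            (add_nonneg (Real.sqrt_nonneg _) (Real.sqrt_nonneg _)) (by positivity)
      _ = η * (Real.sqrt N * Real.sqrt N) / (W₁ + 1) := by field_simp
      _ = η * N / (W₁ + 1) := by rw [hNN]
  have hLip := (abs_primeShiftForm_sub_le (a := a) hGm hum hGb hub hGs hus).trans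
    (mul_le_mul hW₁ hpair (mul_nonneg (Real.sqrt_nonneg _) (add_nonneg (Real.sqrt_nonneg _) (Real.sqrt_nonneg _))) hW₁0)
  have herr : W₁ * (η * N / (W₁ + 1)) ≤ η * N := by
    have e : W₁ * (η * N / (W₁ + 1)) = η * N * (W₁ / (W₁ + 1)) := by field_simp
    rw [e]
    have h1 : W₁ / (W₁ + 1) ≤ 1 := by rw [div_le_one (by positivity)]; linarith only
    have hηN : 0 ≤ η * N := by positivity
    calc η * N * (W₁ / (W₁ + 1)) ≤ η * N * 1 := mul_le_mul_of_nonneg_left h1 hηN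
      _ = η * N := mul_one _
  exact hLip.trans herr

/-- **THE SECOND-ORDER BOUND ON A LINEAR-MODULUS CLASS (under RH, abstract budgets).**  For `a ≥ 4`, an admissible `G` on `[−b, b]`
(`a + s² ≤ b`) with `∫(G(x+t) − G(x))² ≤ (|t|/h)∫G²` (`0 < h ≤ 1`), `0 < η ≤ 1`, `0 < s ≤ 1/6`, weight sum `W` of the window
`b + 1`, approximate eigenvalue `0 ≤ λ₀ ≤ τ` of the profile `C_a` with coupling budget `J_c`, `P₊ ≥ (b+1) + sinh(b+1)`, and the
largeness condition `L + 1 ≤ R_c(a)`, `L = 4(a + sinh a + 3)s² + 8(b − a + h/8)P₊ + 4Ψ(ηh)`: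
`Q_b(G) ≤ (R_c(a) + 6Ws + (√J_c + (3/2)s(W+τ) + W√(2(b − a) + h/4))²/((1 − 3s)(R_c(a) − L)) + 11η)·∫G²`. -/
theorem primeShiftForm_le_coshQuotient_secondOrder_of_RH_of_linearModulus (hRH : RiemannHypothesis)
    {a b h η s Jc W τ Pp : ℝ}
    (ha : 4 ≤ a) (hab : a + s ^ 2 ≤ b) (hh0 : 0 < h) (hh1 : h ≤ 1) (hη0 : 0 < η) (hη1 : η ≤ 1)
    (hs0 : 0 < s) (hs1 : s ≤ 1 / 6)
    (hW : ∑ n ∈ weilPrimeIndex (b + 1), 2 * ((Λ n : ℝ) / Real.sqrt n) ≤ W)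
    {lam0 : ℝ} (hlam0 : 0 ≤ lam0) (hτ : lam0 ≤ τ) (hJc : 0 ≤ Jc)
    (hcoup : ∫ x in Ioo (-a) a,
        ((∑ n ∈ weilPrimeIndex a, (Λ n : ℝ) / Real.sqrt n *
            ((Icc (-a) a).indicator (fun y ↦ Real.cosh (y / 2)) (x - Real.log n)
              + (Icc (-a) a).indicator (fun y ↦ Real.cosh (y / 2)) (x + Real.log n)))
          - lam0 * (Icc (-a) a).indicator (fun y ↦ Real.cosh (y / 2)) x) ^ 2
        ≤ Jc * (a + Real.sinh a))
    (hPp : (b + 1) + Real.sinh (b + 1) ≤ Pp)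
    (hgap : 4 * (a + Real.sinh a + 3) * s ^ 2 + 8 * (b - a + h / 8) * Pp + 4 * weilArchTail (η * h) + 1
        ≤ primeShiftForm a ((Icc (-a) a).indicator (fun y ↦ Real.cosh (y / 2))) / (a + Real.sinh a))
    {G : ℝ → ℝ} {CG : ℝ} (hGm : Measurable G) (hGb : ∀ x, |G x| ≤ CG) (hGs : ∀ x, x ∉ Icc (-b) b → G x = 0)
    (hmod : ∀ t, ∫ x, (G (x + t) - G x) ^ 2 ≤ |t| / h * ∫ x, G x ^ 2) :
    primeShiftForm b G
      ≤ (primeShiftForm a ((Icc (-a) a).indicator (fun y ↦ Real.cosh (y / 2))) / (a + Real.sinh a) + 6 * W * s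
          + (Real.sqrt Jc + (3 / 2 * s * (W + τ) + W * Real.sqrt (2 * (b - a) + h / 4))) ^ 2
            / ((1 - 3 * s) * (primeShiftForm a ((Icc (-a) a).indicator (fun y ↦ Real.cosh (y / 2))) / (a + Real.sinh a)
              - (4 * (a + Real.sinh a + 3) * s ^ 2 + 8 * (b - a + h / 8) * Pp + 4 * weilArchTail (η * h))))
          + 11 * η) * ∫ x, G x ^ 2 := by
  classical
  set N := ∫ x, G x ^ 2 with hNdef
  have hN : 0 ≤ N := integral_nonneg fun x ↦ sq_nonneg _
  have hs2 : 0 < s ^ 2 := by positivity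
  have hab' : a ≤ b := by linarith only [hab, hs2]
  have ha0 : 0 < a := by linarith only [ha]
  have hb0 : 0 < b := ha0.trans_le hab'
  have hPa0 : 0 < a + Real.sinh a := by have := Real.sinh_pos_iff.2 ha0; linarith only [this, ha0]
  -- the weight sum of the big window and the choice of `ε₁`
  set W₁ := ∑ n ∈ weilPrimeIndex (b + 1), 2 * ((Λ n : ℝ) / Real.sqrt n) with hW₁def
  have hW₁0 : 0 ≤ W₁ := Finset.sum_nonneg fun n _ ↦
    mul_nonneg (by norm_num) (div_nonneg ArithmeticFunction.vonMangoldt_nonneg (Real.sqrt_nonneg _))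
  have hW0 : 0 ≤ W := hW₁0.trans hW
  set ε₁ := η ^ 2 * h / (8 * (W₁ + 1) ^ 2) with hε₁def
  have hε₁0 : 0 < ε₁ := by rw [hε₁def]; positivity
  have hε₁h : ε₁ ≤ h / 8 := by
    have hsq1 : (8 : ℝ) ≤ 8 * (W₁ + 1) ^ 2 := by nlinarith only [hW₁0]
    have hη2 : η ^ 2 * h ≤ h := by
      have hη' : η ^ 2 ≤ 1 := by nlinarith only [hη0, hη1]
      nlinarith only [hη', hh0]
    rw [hε₁def]
    calc η ^ 2 * h / (8 * (W₁ + 1) ^ 2) ≤ h / (8 * (W₁ + 1) ^ 2) :=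
          div_le_div_of_nonneg_right hη2 (by positivity)
      _ ≤ h / 8 := div_le_div_of_nonneg_left hh0.le (by norm_num) hsq1
  set b₂ := b + ε₁ with hb₂
  have hbb₂ : b ≤ b₂ := by rw [hb₂]; linarith only [hε₁0]
  have hb₂1 : b₂ ≤ b + 1 := by rw [hb₂]; linarith only [hε₁h, hh1]
  have hab₂ : a + s ^ 2 ≤ b₂ := hab.trans hbb₂
  have hd : b₂ - a ≤ b - a + h / 8 := by rw [hb₂]; linarith only [hε₁h]
  -- the smooth approximant `u`
  obtain ⟨u, hWT, hTS', hum, hub, hus', huN', hinc', hdist'⟩ :=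
    exists_weilTest_near_of_linearModulus hh0 hGm hGb hGs hmod hε₁0
  have hTS : tsupport (fun x ↦ ((u x : ℝ) : ℂ)) ⊆ Icc (-b₂) b₂ := by rw [hb₂]; exact hTS'
  have hus : ∀ x, x ∉ Icc (-b₂) b₂ → u x = 0 := by rw [hb₂]; exact hus'
  have huN : ∫ x, u x ^ 2 ≤ N := by rw [hNdef]; exact huN'
  have hinc : ∀ t, ∫ x, (u (x + t) - u x) ^ 2 ≤ |t| / h * N := by rw [hNdef]; exact hinc'
  have hdist : ∫ x, (u x - G x) ^ 2 ≤ 2 * ε₁ / h * N := by rw [hNdef]; exact hdist'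
  -- the budgets at the window `b₂`
  have hW' : ∑ n ∈ weilPrimeIndex b₂, 2 * ((Λ n : ℝ) / Real.sqrt n) ≤ W := (weightSum_mono hb₂1).trans hW
  have hPp' : b₂ + Real.sinh b₂ ≤ Pp := le_trans (add_le_add hb₂1 (Real.sinh_le_sinh.2 hb₂1)) hPp
  have hPp0 : 0 ≤ Pp := le_trans (by
    have := Real.self_le_sinh_iff.2 (hb0.le.trans hbb₂); linarith only [this, hb0, hbb₂]) hPp'
  have hΨ0 : 0 ≤ weilArchTail (η * h) := (weilArchTail_pos (by positivity)).le
  have hgap' : 4 * (a + Real.sinh a + 3) * s ^ 2 + 8 * (b₂ - a) * Pp + 4 * weilArchTail (η * h) + 1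
      ≤ primeShiftForm a ((Icc (-a) a).indicator (fun y ↦ Real.cosh (y / 2))) / (a + Real.sinh a) := by
    have : 8 * (b₂ - a) * Pp ≤ 8 * (b - a + h / 8) * Pp := by nlinarith only [hd, hPp0]
    linarith only [hgap, this]
  -- the one-test estimate for `u`
  have hcore := primeShiftForm_le_coshQuotient_secondOrder_of_RH hRH ha hab₂ hh0 hh1 hη0 hη1 hs0 hs1 hW' hlam0 hτ hJc
    hcoup hPp' hgap' hWT hTS huN hinc
  -- monotonicity in the collar: replace `b₂ − a` by `b − a + h/8`
  set R := primeShiftForm a ((Icc (-a) a).indicator (fun y ↦ Real.cosh (y / 2))) / (a + Real.sinh a) with hR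
  set L₂ := 4 * (a + Real.sinh a + 3) * s ^ 2 + 8 * (b₂ - a) * Pp + 4 * weilArchTail (η * h) with hL₂
  set L := 4 * (a + Real.sinh a + 3) * s ^ 2 + 8 * (b - a + h / 8) * Pp + 4 * weilArchTail (η * h) with hL
  have hLL : L₂ ≤ L := by
    rw [hL₂, hL]; nlinarith only [hd, hPp0]
  have hgapL : L + 1 ≤ R := hgap
  have hs3 : 0 < 1 - 3 * s := by linarith only [hs1]
  set e₂ := 3 / 2 * s * (W + τ) + W * Real.sqrt (2 * (b₂ - a)) with he₂
  set e₁ := 3 / 2 * s * (W + τ) + W * Real.sqrt (2 * (b - a) + h / 4) with he₁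
  have hτ0 : 0 ≤ τ := hlam0.trans hτ
  have he₂0 : 0 ≤ e₂ := by rw [he₂]; positivity
  have hee : e₂ ≤ e₁ := by
    rw [he₂, he₁]
    have : Real.sqrt (2 * (b₂ - a)) ≤ Real.sqrt (2 * (b - a) + h / 4) := Real.sqrt_le_sqrt (by linarith only [hd])
    nlinarith only [this, hW0]
  have hfrac : (Real.sqrt Jc + e₂) ^ 2 / ((1 - 3 * s) * (R - L₂)) ≤ (Real.sqrt Jc + e₁) ^ 2 / ((1 - 3 * s) * (R - L)) := by
    have hnum : (Real.sqrt Jc + e₂) ^ 2 ≤ (Real.sqrt Jc + e₁) ^ 2 :=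
      pow_le_pow_left₀ (by positivity) (by linarith only [hee]) 2
    have hden : (1 - 3 * s) * (R - L) ≤ (1 - 3 * s) * (R - L₂) := mul_le_mul_of_nonneg_left (by linarith only [hLL]) hs3.le
    have hden0 : 0 < (1 - 3 * s) * (R - L) := mul_pos hs3 (by linarith only [hgapL])
    exact div_le_div₀ (sq_nonneg _) hnum hden0 hden
  clear_value R L₂ L e₂ e₁
  -- comparison `Q_{b₂}(G)` vs `Q_{b₂}(u)`
  have hGs₂ : ∀ x, x ∉ Icc (-b₂) b₂ → G x = 0 := fun x hx ↦ hGs x fun hm ↦ hx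
    ⟨by linarith only [hm.1, hbb₂], by linarith only [hm.2, hbb₂]⟩
  have hQG : primeShiftForm b G = primeShiftForm b₂ G := WeilFormatC.primeShiftForm_eq_of_le hbb₂ hGs
  have hW₁' : (∑ n ∈ weilPrimeIndex b₂, 2 * ((Λ n : ℝ) / Real.sqrt n)) ≤ W₁ := weightSum_mono hb₂1
  have hdist2 : ∫ x, (u x - G x) ^ 2 ≤ (η / (2 * (W₁ + 1))) ^ 2 * N := by
    have e1 : 2 * ε₁ / h * N = (η / (2 * (W₁ + 1))) ^ 2 * N := by
      rw [hε₁def]; field_simp; ring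
    rw [← e1]; exact hdist
  have hLip : |primeShiftForm b₂ G - primeShiftForm b₂ u| ≤ η * N :=
    abs_primeShiftForm_sub_le_of_sq_dist_le hη0.le hW₁' hW₁0 hN hGm hum hGb hub hGs₂ hus (by rw [hNdef]) huN hdist2
  have hdiff := (abs_sub_le_iff.1 hLip).1
  -- assemble
  rw [hQG]
  have h1 : (R + 6 * W * s + (Real.sqrt Jc + e₂) ^ 2 / ((1 - 3 * s) * (R - L₂)) + 10 * η) * N
      ≤ (R + 6 * W * s + (Real.sqrt Jc + e₁) ^ 2 / ((1 - 3 * s) * (R - L)) + 10 * η) * N :=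
    mul_le_mul_of_nonneg_right (by linarith only [hfrac]) hN
  have e : (R + 6 * W * s + (Real.sqrt Jc + e₁) ^ 2 / ((1 - 3 * s) * (R - L)) + 11 * η) * N
      = (R + 6 * W * s + (Real.sqrt Jc + e₁) ^ 2 / ((1 - 3 * s) * (R - L)) + 10 * η) * N + η * N := by ring
  rw [e]
  linarith only [hcore, hdiff, h1]

/-! ## §2 The floor -/

/-- **THE SECOND-ORDER UPPER BOUND FOR THE FLOOR (under RH, abstract budgets)**: see the file header —
`λ_max(a) ≤ R_c(a) + 6Ws + (√J_c + (3/2)s(W+τ) + W√(2h + h/8))²/((1 − 3s)(R_c(a) − L)) + 11η`,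
`L = 4(a + sinh a + 3)s² + 8(h + h/16)P₊ + 4Ψ(ηh/2)`, for `a ≥ 4`, `0 < h ≤ 1`, `s² ≤ h`, `0 < s ≤ 1/6`, `0 < η ≤ 1`,
`W ≥ Σ_{log n < 2(a+h+1)} 2Λ(n)/√n`, `0 ≤ λ₀ ≤ τ` with coupling budget `J_c` at the window `a`, `P₊ ≥ (a+h+1) + sinh(a+h+1)`, under
`L + 1 ≤ R_c(a)` (box envelope of scale `h`, then `primeShiftForm_le_coshQuotient_secondOrder_of_RH_of_linearModulus` on `[−(a+h), a+h]`
at modulus scale `h/2`). -/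
theorem farCoercivityFloor_le_coshQuotient_secondOrder_of_RH (hRH : RiemannHypothesis)
    {a h η s Jc W τ Pp : ℝ}
    (ha : 4 ≤ a) (hh0 : 0 < h) (hh1 : h ≤ 1) (hsh : s ^ 2 ≤ h) (hη0 : 0 < η) (hη1 : η ≤ 1) (hs0 : 0 < s) (hs1 : s ≤ 1 / 6)
    (hW : ∑ n ∈ weilPrimeIndex (a + h + 1), 2 * ((Λ n : ℝ) / Real.sqrt n) ≤ W)
    {lam0 : ℝ} (hlam0 : 0 ≤ lam0) (hτ : lam0 ≤ τ) (hJc : 0 ≤ Jc)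
    (hcoup : ∫ x in Ioo (-a) a,
        ((∑ n ∈ weilPrimeIndex a, (Λ n : ℝ) / Real.sqrt n *
            ((Icc (-a) a).indicator (fun y ↦ Real.cosh (y / 2)) (x - Real.log n)
              + (Icc (-a) a).indicator (fun y ↦ Real.cosh (y / 2)) (x + Real.log n)))
          - lam0 * (Icc (-a) a).indicator (fun y ↦ Real.cosh (y / 2)) x) ^ 2
        ≤ Jc * (a + Real.sinh a))
    (hPp : (a + h + 1) + Real.sinh (a + h + 1) ≤ Pp)
    (hgap : 4 * (a + Real.sinh a + 3) * s ^ 2 + 8 * (h + h / 16) * Pp + 4 * weilArchTail (η * (h / 2)) + 1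
        ≤ primeShiftForm a ((Icc (-a) a).indicator (fun y ↦ Real.cosh (y / 2))) / (a + Real.sinh a)) :
    farCoercivityFloor a
      ≤ primeShiftForm a ((Icc (-a) a).indicator (fun y ↦ Real.cosh (y / 2))) / (a + Real.sinh a) + 6 * W * s
          + (Real.sqrt Jc + (3 / 2 * s * (W + τ) + W * Real.sqrt (2 * h + h / 8))) ^ 2
            / ((1 - 3 * s) * (primeShiftForm a ((Icc (-a) a).indicator (fun y ↦ Real.cosh (y / 2))) / (a + Real.sinh a)
              - (4 * (a + Real.sinh a + 3) * s ^ 2 + 8 * (h + h / 16) * Pp + 4 * weilArchTail (η * (h / 2)))))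
          + 11 * η := by
  have ha0 : 0 < a := by linarith only [ha]
  have hh2 : 0 < h / 2 := by linarith only [hh0]
  have hh21 : h / 2 ≤ 1 := by linarith only [hh1]
  refine farCoercivityFloor_le_of_shiftBound ha0 fun g C hgm hC hsupp ↦ ?_
  obtain ⟨G, hGm, -, hGb, hGs, hGN, hQ, hinc⟩ := exists_boxEnvelope hh0 hgm hC hsupp
  have hab : a + s ^ 2 ≤ a + h := by linarith only [hsh]
  have e1 : a + h - a + h / 2 / 8 = h + h / 16 := by ring
  have e2 : 2 * (a + h - a) + h / 2 / 4 = 2 * h + h / 8 := by ring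
  have hgap' : 4 * (a + Real.sinh a + 3) * s ^ 2 + 8 * (a + h - a + h / 2 / 8) * Pp + 4 * weilArchTail (η * (h / 2)) + 1
      ≤ primeShiftForm a ((Icc (-a) a).indicator (fun y ↦ Real.cosh (y / 2))) / (a + Real.sinh a) := by
    rw [e1]; exact hgap
  have hclass := primeShiftForm_le_coshQuotient_secondOrder_of_RH_of_linearModulus hRH (b := a + h) (h := h / 2)
    ha hab hh2 hh21 hη0 hη1 hs0 hs1 hW hlam0 hτ hJc hcoup hPp hgap' hGm hGb hGs hinc
  rw [e1, e2, hGN] at hclass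
  exact hQ.trans hclass

end FloorCoshSplit

end Summit.RiemannHypothesis.RiemannHypothesis.Theorems.WeilFormatC
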